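import Summits.QuantumFields.YangMills.Theorems.LangevinControlUVOSLegsAtWeakCouplingCSketchGermRot
import Summits.QuantumFields.YangMills.Theorems.LangevinControlUVOSLegsAtWeakCouplingCSketchGermWardOrbit
import Summits.QuantumFields.YangMills.Theorems.LangevinControlUVOSLegsAtWeakCouplingCStubLocalityFlatApprox
import Summits.QuantumFields.YangMills.Theorems.PencilRigidityNPointIsotropyMopupHelpers
import HarnessLib

/-!
# Crux `OSLegsAtWeakCouplingC` (stmt-QuantumFields-16207), line `Sketch`: the E1 import in Ward-identity form

Support file (lead c3).  The line's one dynamical import is E1 on the germ.  In `…SketchGermRot` it was sharpened to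
germ invariance under the det-1 isometries of the `(x₀,x₁)`-plane for reflection-positive, density-bounded,
signed-permutation-invariant soft-bundle limits (`osLegsAtWeakCouplingC_of_fcp6_germRot`, p135054).  Here it is
reduced further to its INFINITESIMAL form, the **rotation Ward identity on the germ** — the shape in which a dynamical
argument (lattice rotation Ward identity + irrelevance of the dimension-6 breaking operators) would deliver it:

`GermWard`: along every weak-coupling soft bundle (compact simple `G`, continuous unit map with H1–H3, limit `S₁`
reflection positive on positive-time tuples, density-bounded off the diagonal, signed-permutation invariant) there is
`r₀ > 0` such that for every `n ≥ 2` and every compactly supported, separated, off-diagonal test function `F` supported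
in configurations of diameter `< r₀`, `S₁ n D = 0` for the (any) Schwartz function `D` with
`D x = DF(x)(Y x)`, `(Y x)_k = x_k⁰ e₁ − x_k¹ e₀` (the generator of the rotations of the `(x₀,x₁)`-plane).

* `germInvariant_planeRot_of_ward` — for a density-bounded `S₁`, the Ward identity on the germ gives invariance of
  the germ under every `planeRot 0 θ` (orbit constancy `GermWard.orbit_eq_of_ward` of `…SketchGermWardOrbit` on the
  dense class; the class is dense in the germ by the landed cutoffs `exists_offDiagonal_cutoff_tendsto'` and pair
  cutoffs `exists_pairCutoff_tendsto`, whose supports stay inside `tsupport F`; both sides are continuous in `F`).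
* `germRot_of_germWard` — hence `GermWard` implies the `GermRot` import of `…SketchGermRot` (a det-1 isometry fixing
  `e₂, e₃` is a `planeRot 0 φ`: the landed `Mopup.exists_eq_planeRot`); `germWard_of_germRot` — and conversely
  (uniqueness of derivatives), so the two imports are equivalent along soft bundles.
* `osLegsAtWeakCouplingC_of_fcp6_germWard` — **the crux BY NAME from `stub_fcp6` and `GermWard`** (conditional).

Tree vocabulary only; no definitions.  Refs: OsterwalderSchrader1973 §4.2 (4.15); OsterwalderSchrader1975;
GlimmJaffe1987 §6.1/§19; JaffeWitten2000 §4/§6.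
-/

set_option autoImplicit false

noncomputable section

open scoped SchwartzMap
open MeasureTheory Filter Topology Set Metric
open Literature.MathematicalPhysics.QuantumFieldTheory Literature.MathematicalPhysics.QuantumLattice
open Literature.MathematicalPhysics.AQFT
open Summit.QuantumFields.YangMills.Theses.LangevinControlUV (OSLegsAtWeakCouplingC)
open Summit.QuantumFields.YangMills.Cruxes.OSLegsFromFemtoAndGap.DlrCollarTransfer
open Summit.QuantumFields.YangMills.Theorems.NPointIsotropy.Negative (E4)
open Summit.QuantumFields.YangMills.Theorems.NPointIsotropy.ComplexRotationBandlimit.Mopup (exists_eq_planeRot)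
open Summit.QuantumFields.YangMills.Theorems.OSLegsFromFemtoAndGap (exists_offDiagonal_cutoff_tendsto')
open Summit.QuantumFields.YangMills.Theorems.OSLegsAtWeakCouplingC (exists_pairCutoff_tendsto)

namespace Summit.QuantumFields.YangMills.Cruxes.OSLegsAtWeakCouplingC.Sketch

namespace GermWard

variable {n : ℕ}

/-- A test function supported at pairwise distances `≥ δ > 0` is in `⁰𝒮` (the coincidence locus misses its support,
so all derivatives vanish there). -/
theorem isOffDiagonal_of_tsupport_subset_separated {G : 𝓢((Fin n → E4), ℂ)} {δ : ℝ} (hδ : 0 < δ)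
    (h : tsupport (G : (Fin n → E4) → ℂ) ⊆ Separated n δ) : IsOffDiagonal G := by
  intro x hx k
  obtain ⟨i, j, hij, hxij⟩ := hx
  have hx' : x ∉ tsupport (G : (Fin n → E4) → ℂ) := fun hx' => by
    have hd := h hx' i j hij
    rw [hxij, dist_self] at hd
    exact absurd hd (not_le.2 hδ)
  exact Function.notMem_support.1 fun hk => hx' (support_iteratedFDeriv_subset k hk)

/-- **Germ invariance under the plane rotations from the Ward identity on the germ.**  For a one-field family with
bounded densities off the diagonal, if `S₁ n` annihilates the generator derivative of every compactly supported,
separated, off-diagonal test function of diameter `< r₀` (all `n ≥ 2`), and `S₁ 1 = 0`, then every rotation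
`planeRot 0 θ` of the `(x₀,x₁)`-plane fixes `S₁` on the germ of diameter `r₀` (degree `0`: the action is trivial). -/
theorem germInvariant_planeRot_of_ward (S₁ : SchwingerFamily E4) (hdens : OffDiagDensity S₁)
    (h1 : ∀ F : 𝓢((Fin 1 → E4), ℂ), S₁ 1 F = 0) {r₀ : ℝ}
    (hward : ∀ (n : ℕ), 2 ≤ n → ∀ (F D : 𝓢((Fin n → E4), ℂ)), IsOffDiagonal F → HasCompactSupport (F : (Fin n → E4) → ℂ) →
      (∃ δ : ℝ, 0 < δ ∧ tsupport (F : (Fin n → E4) → ℂ) ⊆ Separated n δ) →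
      tsupport (F : (Fin n → E4) → ℂ) ⊆ SmallDiam n r₀ →
      (∀ x, D x = fderiv ℝ (F : (Fin n → E4) → ℂ) x
        (fun k => (x k 0) • (EuclideanSpace.single 1 1 : E4) - (x k 1) • (EuclideanSpace.single 0 1 : E4))) →
      S₁ n D = 0)
    (θ : ℝ) : GermInvariant S₁ (planeRot (0 : Fin 3) θ) r₀ := by
  intro n F hF hFr
  -- degrees `0` and `1`: the action is trivial, resp. `S₁ 1 = 0`
  rcases Nat.lt_or_ge n 2 with hn | hn
  · interval_cases n
    · congr 1
      ext x
      rw [linActMulti_apply]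
      congr 1
      exact funext fun i => Fin.elim0 i
    · rw [h1, h1]
  -- the invariance set is closed
  have hclosed : IsClosed {G : 𝓢((Fin n → E4), ℂ) | S₁ n (linActMulti (planeRot (0 : Fin 3) θ) G) = S₁ n G} :=
    isClosed_eq ((S₁ n).continuous.comp (linActMulti (planeRot (0 : Fin 3) θ)).continuous) (S₁ n).continuous
  -- it contains the compactly supported separated test functions supported inside `tsupport F`
  set A : Set 𝓢((Fin n → E4), ℂ) := {G | HasCompactSupport (G : (Fin n → E4) → ℂ) ∧
    (∃ δ : ℝ, 0 < δ ∧ tsupport (G : (Fin n → E4) → ℂ) ⊆ Separated n δ) ∧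
    tsupport (G : (Fin n → E4) → ℂ) ⊆ tsupport (F : (Fin n → E4) → ℂ)} with hA
  have hsub : A ⊆ {G : 𝓢((Fin n → E4), ℂ) | S₁ n (linActMulti (planeRot (0 : Fin 3) θ) G) = S₁ n G} := by
    rintro G ⟨hGc, ⟨δ, hδ, hGδ⟩, hGF⟩
    exact orbit_eq_of_ward S₁ hdens (hward n hn) G (isOffDiagonal_of_tsupport_subset_separated hδ hGδ) hGc hδ hGδ
      (hGF.trans hFr) θ
  -- and `F` lies in its closure
  suffices hmem : F ∈ closure A from hclosed.closure_subset_iff.2 hsub hmem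
  obtain ⟨u, husupp, huoff, hulim⟩ := exists_offDiagonal_cutoff_tendsto' F hF
  refine isClosed_closure.mem_of_tendsto hulim (Eventually.of_forall fun m => ?_)
  obtain ⟨v, hv, hvlim⟩ := exists_pairCutoff_tendsto (huoff m) ((husupp m).trans Set.inter_subset_right)
  refine mem_closure_of_tendsto hvlim (Eventually.of_forall fun j => ⟨?_, ⟨((j : ℝ) + 1)⁻¹, by positivity, ?_⟩, ?_⟩)
  · exact IsCompact.of_isClosed_subset (isCompact_closedBall _ _) (isClosed_tsupport _)
      ((hv j).trans (Set.inter_subset_left.trans ((husupp m).trans Set.inter_subset_right)))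
  · intro x hx
    simp only [Separated, Set.mem_setOf_eq, dist_eq_norm]
    exact ((hv j) hx).2
  · exact (hv j).trans (Set.inter_subset_left.trans ((husupp m).trans Set.inter_subset_left))

end GermWard

open GermWard in
/-- **The Ward-identity import implies the sharpened germ import** (`GermRot` of `…SketchGermRot`): along every
soft bundle as there, the rotation Ward identity on the germ gives germ invariance under every det-1 isometry of the
`(x₀,x₁)`-plane — such an isometry is a `planeRot 0 φ` (`Mopup.exists_eq_planeRot`), and the density bound available
among the hypotheses integrates the identity along the orbit (`germInvariant_planeRot_of_ward`). -/
theorem germRot_of_germWard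
    (hward : ∀ (G : Type) [Group G] [TopologicalSpace G] [IsTopologicalGroup G] [CompactSpace G]
      [MeasurableSpace G] [BorelSpace G], IsCompactSimpleLieGroup G →
      ∀ (r : LatticeRep G) (a : ℝ → ℝ) (sch : SpeciesScheme (YMSpecies G)) (S₁ : SchwingerFamily E4)
        (Tq : (n : ℕ) → (Fin n → Fin 4 × Fin 4) → (𝓢((Fin n → E4), ℂ) →L[ℂ] ℂ)) (K : ℝ) (b₀ : ℝ) (g : ℝ → ℕ → ℕ),
        Continuous a → TwoPoint G r a → Skewness G r a → GapInUnits G r a → SoftBundle G r a sch S₁ Tq K b₀ g →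
        RPPos S₁ → OffDiagDensity S₁ → (∀ R : E4 ≃ₗᵢ[ℝ] E4, IsSignedPerm R → Invariant S₁ R) →
          ∃ r₀ : ℝ, 0 < r₀ ∧ ∀ (n : ℕ), 2 ≤ n → ∀ (F D : 𝓢((Fin n → E4), ℂ)), IsOffDiagonal F →
            HasCompactSupport (F : (Fin n → E4) → ℂ) →
            (∃ δ : ℝ, 0 < δ ∧ tsupport (F : (Fin n → E4) → ℂ) ⊆ Separated n δ) →
            tsupport (F : (Fin n → E4) → ℂ) ⊆ SmallDiam n r₀ →
            (∀ x, D x = fderiv ℝ (F : (Fin n → E4) → ℂ) x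
              (fun k => (x k 0) • (EuclideanSpace.single 1 1 : E4) - (x k 1) • (EuclideanSpace.single 0 1 : E4))) →
            S₁ n D = 0) :
    ∀ (G : Type) [Group G] [TopologicalSpace G] [IsTopologicalGroup G] [CompactSpace G]
      [MeasurableSpace G] [BorelSpace G], IsCompactSimpleLieGroup G →
      ∀ (r : LatticeRep G) (a : ℝ → ℝ) (sch : SpeciesScheme (YMSpecies G)) (S₁ : SchwingerFamily E4)
        (Tq : (n : ℕ) → (Fin n → Fin 4 × Fin 4) → (𝓢((Fin n → E4), ℂ) →L[ℂ] ℂ)) (K : ℝ) (b₀ : ℝ) (g : ℝ → ℕ → ℕ),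
        Continuous a → TwoPoint G r a → Skewness G r a → GapInUnits G r a → SoftBundle G r a sch S₁ Tq K b₀ g →
        RPPos S₁ → OffDiagDensity S₁ → (∀ R : E4 ≃ₗᵢ[ℝ] E4, IsSignedPerm R → Invariant S₁ R) →
          ∃ r₀ : ℝ, 0 < r₀ ∧ ∀ R : E4 ≃ₗᵢ[ℝ] E4, LinearMap.det (R.toLinearEquiv : E4 →ₗ[ℝ] E4) = 1 →
            IsPlanar01 R → GermInvariant S₁ R r₀ := by
  intro G _ _ _ _ _ _ hG r a sch S₁ Tq K b₀ g ha h1 h2 h3 hB hRP hdens hsigned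
  obtain ⟨r₀, hr₀, hW⟩ := hward G hG r a sch S₁ Tq K b₀ g ha h1 h2 h3 hB hRP hdens hsigned
  -- the bundle's one-point clause `S₁ 1 = 0`
  obtain ⟨⟨-, -, -, -, -, -, -, -, -, hS1, -⟩, -⟩ := hB
  refine ⟨r₀, hr₀, fun R hdet hR => ?_⟩
  obtain ⟨φ, rfl⟩ := exists_eq_planeRot R hdet hR.1 hR.2
  exact germInvariant_planeRot_of_ward S₁ hdens hS1 hW φ

open GermWard Summit.QuantumFields.YangMills.Theorems.CurvatureBoostCovariance.BoostsInheritMirrors.OrbitBandlimit in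
/-- **Conversely, the sharpened germ import implies the Ward-identity import** (so the two are EQUIVALENT along soft
bundles, the density bound being among the hypotheses of both): if every det-1 planar isometry fixes the germ, the orbit
function of a compactly supported separated `F` in the germ is constant, while it has derivative `S₁ n D` at `0`
(`GermWard.hasDerivAt_orbit_zero`); derivatives are unique. -/
theorem germWard_of_germRot
    (hrot : ∀ (G : Type) [Group G] [TopologicalSpace G] [IsTopologicalGroup G] [CompactSpace G]
      [MeasurableSpace G] [BorelSpace G], IsCompactSimpleLieGroup G →
      ∀ (r : LatticeRep G) (a : ℝ → ℝ) (sch : SpeciesScheme (YMSpecies G)) (S₁ : SchwingerFamily E4)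
        (Tq : (n : ℕ) → (Fin n → Fin 4 × Fin 4) → (𝓢((Fin n → E4), ℂ) →L[ℂ] ℂ)) (K : ℝ) (b₀ : ℝ) (g : ℝ → ℕ → ℕ),
        Continuous a → TwoPoint G r a → Skewness G r a → GapInUnits G r a → SoftBundle G r a sch S₁ Tq K b₀ g →
        RPPos S₁ → OffDiagDensity S₁ → (∀ R : E4 ≃ₗᵢ[ℝ] E4, IsSignedPerm R → Invariant S₁ R) →
          ∃ r₀ : ℝ, 0 < r₀ ∧ ∀ R : E4 ≃ₗᵢ[ℝ] E4, LinearMap.det (R.toLinearEquiv : E4 →ₗ[ℝ] E4) = 1 →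
            IsPlanar01 R → GermInvariant S₁ R r₀) :
    ∀ (G : Type) [Group G] [TopologicalSpace G] [IsTopologicalGroup G] [CompactSpace G]
      [MeasurableSpace G] [BorelSpace G], IsCompactSimpleLieGroup G →
      ∀ (r : LatticeRep G) (a : ℝ → ℝ) (sch : SpeciesScheme (YMSpecies G)) (S₁ : SchwingerFamily E4)
        (Tq : (n : ℕ) → (Fin n → Fin 4 × Fin 4) → (𝓢((Fin n → E4), ℂ) →L[ℂ] ℂ)) (K : ℝ) (b₀ : ℝ) (g : ℝ → ℕ → ℕ),
        Continuous a → TwoPoint G r a → Skewness G r a → GapInUnits G r a → SoftBundle G r a sch S₁ Tq K b₀ g →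
        RPPos S₁ → OffDiagDensity S₁ → (∀ R : E4 ≃ₗᵢ[ℝ] E4, IsSignedPerm R → Invariant S₁ R) →
          ∃ r₀ : ℝ, 0 < r₀ ∧ ∀ (n : ℕ), 2 ≤ n → ∀ (F D : 𝓢((Fin n → E4), ℂ)), IsOffDiagonal F →
            HasCompactSupport (F : (Fin n → E4) → ℂ) →
            (∃ δ : ℝ, 0 < δ ∧ tsupport (F : (Fin n → E4) → ℂ) ⊆ Separated n δ) →
            tsupport (F : (Fin n → E4) → ℂ) ⊆ SmallDiam n r₀ →
            (∀ x, D x = fderiv ℝ (F : (Fin n → E4) → ℂ) x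
              (fun k => (x k 0) • (EuclideanSpace.single 1 1 : E4) - (x k 1) • (EuclideanSpace.single 0 1 : E4))) →
            S₁ n D = 0 := by
  intro G _ _ _ _ _ _ hG r a sch S₁ Tq K b₀ g ha h1 h2 h3 hB hRP hdens hsigned
  obtain ⟨r₀, hr₀, hR⟩ := hrot G hG r a sch S₁ Tq K b₀ g ha h1 h2 h3 hB hRP hdens hsigned
  refine ⟨r₀, hr₀, fun n _ F D hF hFc hδ hFr hD => ?_⟩
  obtain ⟨δ, hδ, hFδ⟩ := hδ
  obtain ⟨B, hB⟩ := hdens n δ hδ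
  have hder := hasDerivAt_orbit_zero S₁ hB F D hFc hFδ hD
  have hconst : (fun θ : ℝ => S₁ n (linActMulti (planeRot (0 : Fin 3) θ) F)) = fun _ => S₁ n F :=
    funext fun θ => hR (planeRot (0 : Fin 3) θ) (det_planeRot θ) ⟨planeRot_single_two θ, planeRot_single_three θ⟩ n F hF hFr
  rw [hconst] at hder
  exact hder.unique (hasDerivAt_const (0 : ℝ) (S₁ n F))

/-- **The crux from `stub_fcp6` and the E1 import in Ward-identity form** (conditional result):
`OSLegsAtWeakCouplingC` BY NAME from the frozen-boundary femto package and the rotation Ward identity on the germ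
along weak-coupling soft bundles (`germRot_of_germWard`, then `osLegsAtWeakCouplingC_of_fcp6_germRot`). -/
theorem osLegsAtWeakCouplingC_of_fcp6_germWard (hfcp : Statement.stub_fcp6)
    (hward : ∀ (G : Type) [Group G] [TopologicalSpace G] [IsTopologicalGroup G] [CompactSpace G]
      [MeasurableSpace G] [BorelSpace G], IsCompactSimpleLieGroup G →
      ∀ (r : LatticeRep G) (a : ℝ → ℝ) (sch : SpeciesScheme (YMSpecies G)) (S₁ : SchwingerFamily E4)
        (Tq : (n : ℕ) → (Fin n → Fin 4 × Fin 4) → (𝓢((Fin n → E4), ℂ) →L[ℂ] ℂ)) (K : ℝ) (b₀ : ℝ) (g : ℝ → ℕ → ℕ),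
        Continuous a → TwoPoint G r a → Skewness G r a → GapInUnits G r a → SoftBundle G r a sch S₁ Tq K b₀ g →
        RPPos S₁ → OffDiagDensity S₁ → (∀ R : E4 ≃ₗᵢ[ℝ] E4, IsSignedPerm R → Invariant S₁ R) →
          ∃ r₀ : ℝ, 0 < r₀ ∧ ∀ (n : ℕ), 2 ≤ n → ∀ (F D : 𝓢((Fin n → E4), ℂ)), IsOffDiagonal F →
            HasCompactSupport (F : (Fin n → E4) → ℂ) →
            (∃ δ : ℝ, 0 < δ ∧ tsupport (F : (Fin n → E4) → ℂ) ⊆ Separated n δ) →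
            tsupport (F : (Fin n → E4) → ℂ) ⊆ SmallDiam n r₀ →
            (∀ x, D x = fderiv ℝ (F : (Fin n → E4) → ℂ) x
              (fun k => (x k 0) • (EuclideanSpace.single 1 1 : E4) - (x k 1) • (EuclideanSpace.single 0 1 : E4))) →
            S₁ n D = 0) :
    OSLegsAtWeakCouplingC :=
  osLegsAtWeakCouplingC_of_fcp6_germRot hfcp (germRot_of_germWard hward)

end Summit.QuantumFields.YangMills.Cruxes.OSLegsAtWeakCouplingC.Sketch

end
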